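import Literature.AnabelianGeometry.EtaleTheta.Discharge.Sec1Prop15iiiOfThetaKummerInput
import Literature.AnabelianGeometry.EtaleTheta.Discharge.Sec1ThetaKernel
import Literature.AnabelianGeometry.EtaleTheta.ThetaSettingTopology
import HarnessLib

/-!
# [EtTh] Prop. 1.5 (iii), the Prop. 1.3 binder: the `Θ`-LIFT of the Kummer class of `Θ̈` EXISTS and restricts to
# `log(Θ)` — from two function-level clauses; hence Prop. 1.5 (iii) in full from the Kummer theory of functions

S. Mochizuki, *The étale theta function and its Frobenioid-theoretic manifestations*, Publ. RIMS **45**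
(2009) [EtTh], §1, Prop. 1.5 (iii), PRIMS PDF p. 23 (printed 249): "Any class `η̈^Θ ∈ H¹(Π^tp_Ÿ, Δ_Θ)` arises
from a unique class `η̈^Θ ∈ H¹((Π^tp_Ÿ)^Θ, Δ_Θ)` that maps to `log(Θ)` in the quotient `F̈⁰/F̈¹` …"; Prop. 1.3
p. 20 («… restriction to `Δ_Θ` … the natural isomorphism»); §1 p. 12 («`Δ_Θ ≅ Ẑ(1)`»); proof p. 23 «Assertion (iii)
follows from Propositions 1.3; 1.4, (ii), (iii)». [cite: MochizukiEtTh2009, Prop 1.5 (iii) p.23]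
Layer L2 of the abc-iut cell, seat abc-iut-L2-t12 (gen 7), sequel of `Discharge/Sec1Prop15iiiOfThetaKummerInput.lean`
(p458029). PROOF-ONLY (no `def`, no instance, no `Prop` fact), consumed BY NAME, nothing restated.

WHAT THIS FILE DOES. In `Sec1Prop15iiiOfThetaKummerInput` the `Z`-action display of the typed
`ThetaSetting.Prop15iii` became a theorem of function-level identities, leaving as the ONE structural binder the
`Θ`-lift `x′ ∈ H¹((Π^tp_Ÿ)^Θ, Δ_Θ)` of `κ(Θ̈)` with `res_{Δ_Θ} x′ = log(Θ)` ("arises from a unique class", the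
Prop. 1.3 half). HERE that binder becomes a THEOREM of:
* a GENERIC degree-one descent for the tree's `ContH1` (`ContH1.exists_infl_mk_eq_mk`): along a continuous OPEN
  homomorphism `ψ : G₀ → G'` whose kernel lies in `H₀`, a continuous cocycle of `H₀` that is trivial on `Ker ψ`
  is INFLATED from a continuous cocycle of `ψ(H₀)` (values transported along `ψ`; continuity by the quotient
  property of `ψ|H₀ : H₀ ↠ ψ(H₀)`, `isQuotientMap_rangeRestrict_of_isOpenMap`; openness of a quotient
  homomorphism of topological groups, `isOpenMap_of_isQuotientMap`);
* the census predicate `ThetaSetting.HasThetaTopology` (abc-iut-L2-t1, R3: `(Π^tp_X)^Θ` carries the quotient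
  topology) and abc-iut-L2-t1's `ker_toTheta_le_GtpYdd` (`Ker(Π^tp_X ↠ (Π^tp_X)^Θ) ≤ Π^tp_Ÿ`, unconditional);
* two FUNCTION-LEVEL clauses on abc-iut-L2-t12's `ThetaKummerInput T` quoting print: **(hroots)** «the compatible
  roots of `Θ̈` are fixed by `Ker(Π^tp_X ↠ (Π^tp_X)^Θ)`» — the coverings `Ÿ[Θ̈^{1/N}]` are dominated by the
  `Θ`-quotient tower (p. 20: `η^Θ` is built from quotients of `(Π^tp_X)^Θ`); **(hΔ)** «`Δ_Θ` acts on the roots of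
  `Θ̈` through the coefficient isomorphism `Λ(Fn) ≅ Δ_Θ`» — p. 20/p. 12: the restriction of `η̈^Θ` to `Δ_Θ ≅ Ẑ(1)`
  is the tautological class (it "maps to `log(Θ)`").

RESULTS: `ThetaKummerInput.exists_thetaLift_kummerTheta` — `∃ x′, infl x′ = κ(Θ̈) ∧ res_{Δ_Θ} x′ = log(Θ)`;
`ThetaKummerInput.existsUnique_thetaLift_kummerTheta` (with abc-iut-L2-t12's gen-0 `inflTheta_injective`); and the
FULL Prop. 1.5 (iii) from the Kummer theory of functions: `KummerCore.prop15iii_of_thetaKummerInput_of_hasThetaTopology`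
(core datum), `…_ofSection_…` (section datum), `EtaleThetaData.prop15iii_of_thetaKummerInput_of_hasThetaTopology`
(any étale-theta datum with `η̈^Θ = κ(Θ̈)`, Kummer-side binders `hkres`/`hU`/`hQ` kept) — binders = `HasThetaTopology`,
`ConstCompat`, `hlogU`, (hroots), (hΔ), and the four function identities of Prop. 1.4 (ii). HONEST FRAMING: classical
Kummer theory / topology over the frozen root; nothing of [EtTh] asserted; typed ≠ proved; no side taken on
[IUTchIII] Cor. 3.12.
-/

noncomputable section

namespace Literature.AnabelianGeometry.EtaleTheta

open Literature.AnabelianGeometry.SemiGraphs _root_.Topology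
open scoped IsMulCommutative

/-! ### 1. Generic: openness of quotient homomorphisms and degree-one descent for `ContH1` -/

section Generic

variable {G₀ G' : Type*} [Group G₀] [TopologicalSpace G₀] [IsTopologicalGroup G₀]
  [Group G'] [TopologicalSpace G'] [IsTopologicalGroup G'] {ψ : G₀ →* G'}

omit [IsTopologicalGroup G'] in
/-- A homomorphism of topological groups that is a topological quotient map is an OPEN map (the saturation
of an open `V` is `⋃_{k ∈ Ker ψ} V·k`). [cite: NeukirchSchmidtWingberg2008, I §1] -/
theorem isOpenMap_of_isQuotientMap (hq : IsQuotientMap ψ) : IsOpenMap ψ := by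
  intro V hV
  rw [← hq.isOpen_preimage]
  have hsat : (ψ : G₀ → G') ⁻¹' ((ψ : G₀ → G') '' V) = ⋃ k ∈ ψ.ker, (fun v => v * k) '' V := by
    ext x
    simp only [Set.mem_preimage, Set.mem_image, Set.mem_iUnion, exists_prop]
    constructor
    · rintro ⟨v, hv, hvx⟩
      exact ⟨v⁻¹ * x, by rw [MonoidHom.mem_ker, map_mul, map_inv, hvx, inv_mul_cancel], v, hv,
        mul_inv_cancel_left v x⟩
    · rintro ⟨k, hk, v, hv, rfl⟩
      exact ⟨v, hv, by rw [map_mul, MonoidHom.mem_ker.mp hk, mul_one]⟩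
  rw [hsat]
  exact isOpen_biUnion fun k _ => (Homeomorph.mulRight k).isOpenMap V hV

omit [IsTopologicalGroup G₀] [IsTopologicalGroup G'] in
/-- For an open homomorphism `ψ` whose kernel lies in `H₀`, the surjection `H₀ ↠ ψ(H₀)` is a topological
quotient map (open: `ψ(V ∩ H₀) = ψ(V) ∩ ψ(H₀)` by `Ker ψ ≤ H₀`). [cite: NeukirchSchmidtWingberg2008, I §1] -/
theorem isQuotientMap_rangeRestrict_of_isOpenMap (hψ : Continuous ψ) (hopen : IsOpenMap ψ)
    {H₀ : Subgroup G₀} (hker : ψ.ker ≤ H₀) :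
    IsQuotientMap (fun h : H₀ => (⟨ψ h, ⟨h, h.2, rfl⟩⟩ : H₀.map ψ)) := by
  refine IsOpenMap.isQuotientMap ?_ ((hψ.comp continuous_subtype_val).subtype_mk _) ?_
  · intro O hO
    obtain ⟨V, hV, rfl⟩ := isOpen_induced_iff.mp hO
    refine isOpen_induced_iff.mpr ⟨(ψ : G₀ → G') '' V, hopen V hV, ?_⟩
    ext y
    simp only [Set.mem_preimage, Set.mem_image]
    constructor
    · rintro ⟨v, hv, hvy⟩
      obtain ⟨h, hh, hhy⟩ := y.2
      have hk : h⁻¹ * v ∈ ψ.ker := by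
        rw [MonoidHom.mem_ker, map_mul, map_inv, hvy, hhy, inv_mul_cancel]
      have hvH : v ∈ H₀ := by simpa using H₀.mul_mem hh (hker hk)
      exact ⟨⟨v, hvH⟩, hv, Subtype.ext hvy⟩
    · rintro ⟨h, hh, rfl⟩
      exact ⟨h, hh, rfl⟩
  · rintro ⟨y, h, hh, rfl⟩
    exact ⟨⟨h, hh⟩, rfl⟩

variable {A : Subgroup G'} [A.Normal] [IsMulCommutative A]

omit [IsTopologicalGroup G₀] in
/-- **Degree-one descent for `ContH1`.** Along a continuous open homomorphism `ψ : G₀ → G'` with `Ker ψ ≤ H₀`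
(`G₀` acting on `A ⊴ G'` by conjugation through `ψ`), a continuous cocycle `f` of `H₀` that is TRIVIAL ON `Ker ψ`
is inflated from a continuous cocycle `g` of `ψ(H₀)` with `g(ψ h) = f(h)`: well defined because
`f(hk) = f(h)·(h·f(k)) = f(h)`, continuous because `H₀ ↠ ψ(H₀)` is a quotient map.
[cite: NeukirchSchmidtWingberg2008, I §5] -/
theorem ContH1.exists_infl_mk_eq_mk (hψ : Continuous ψ) (hopen : IsOpenMap ψ) {H₀ : Subgroup G₀}
    (hker : ψ.ker ≤ H₀) (f : H₀ → A) (hf : f ∈ contCocycles ψ A H₀) (hf1 : ∀ h : H₀, ψ h = 1 → f h = 1) :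
    ∃ (g : H₀.map ψ → A) (hg : g ∈ contCocycles (MonoidHom.id G') A (H₀.map ψ)),
      (∀ h : H₀, g ⟨ψ h, ⟨h, h.2, rfl⟩⟩ = f h) ∧
        ContH1.infl A ψ hψ le_rfl (ContH1.mk g hg) = ContH1.mk f hf := by
  classical
  have hlift : ∀ y : H₀.map ψ, ∃ h : H₀, ψ h = y := fun y => by
    obtain ⟨h, hh, hy⟩ := y.2
    exact ⟨⟨h, hh⟩, hy⟩
  choose lift hlift using hlift
  -- `f` is constant on the fibres of `ψ`
  have hwd : ∀ h₁ h₂ : H₀, ψ h₁ = ψ h₂ → f h₁ = f h₂ := by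
    intro h₁ h₂ he
    have hk : ψ ((h₁⁻¹ * h₂ : H₀) : G₀) = 1 := by
      rw [Subgroup.coe_mul, Subgroup.coe_inv, map_mul, map_inv, he, inv_mul_cancel]
    have := hf.2 h₁ (h₁⁻¹ * h₂)
    rw [mul_inv_cancel_left, hf1 _ hk, map_one, mul_one] at this
    exact this.symm
  refine ⟨fun y => f (lift y), ⟨?_, fun y y' => ?_⟩, fun h => hwd _ _ (hlift _), ?_⟩
  · -- continuity through the quotient map `H₀ ↠ ψ(H₀)`
    have hq := isQuotientMap_rangeRestrict_of_isOpenMap hψ hopen hker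
    refine hq.continuous_iff.mpr ?_
    have : ((fun y => f (lift y)) ∘ fun h : H₀ => (⟨ψ h, ⟨h, h.2, rfl⟩⟩ : H₀.map ψ)) = f :=
      funext fun h => hwd _ _ (hlift _)
    rw [this]
    exact hf.1
  · -- cocycle identity
    have e : ψ ((lift y * lift y' : H₀) : G₀) = ψ ((lift (y * y') : H₀) : G₀) := by
      rw [Subgroup.coe_mul, map_mul, hlift, hlift, hlift, Subgroup.coe_mul]
    show f (lift (y * y')) = f (lift y) * MulAut.conjNormal ((MonoidHom.id G') (y : G')) (f (lift y'))
    rw [← hwd _ _ e, hf.2, hlift, MonoidHom.id_apply]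
  · change ContH1.mk (fun h : H₀ => f (lift ⟨ψ h, ⟨h, h.2, rfl⟩⟩)) _ = ContH1.mk f hf
    exact ContH1.mk_congr _ (funext fun h => hwd _ _ (hlift _)) _ _

end Generic

namespace ThetaSetting

variable {p : ℕ} [Fact p.Prime] {D : ThetaSetting p}

namespace ThetaKummerInput

variable (T : D.ThetaKummerInput)

/-! ### 2. The `Θ`-lift of `κ(Θ̈)` -/

/-- **The `Θ`-lift of the Kummer class of `Θ̈` exists and restricts to `log(Θ)`** ("arises from a unique class …
that maps to `log(Θ)`", the Prop. 1.3 half of Prop. 1.5 (iii)), from `HasThetaTopology` and the two function-level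
clauses (hroots) «`Ker(Π^tp_X ↠ (Π^tp_X)^Θ)` fixes the compatible roots of `Θ̈`» and (hΔ) «`Δ_Θ` acts on the roots
of `Θ̈` through the coefficient map». [cite: MochizukiEtTh2009, Prop 1.5 (iii) p.23] -/
theorem exists_thetaLift_kummerTheta (hC : D.Compat) (hT : D.HasThetaTopology)
    (hroots : ∀ g : D.PiTemp, D.toTheta g = 1 → ∀ n : ℕ+, g • T.thetaRoots.root n = T.thetaRoots.root n)
    (hΔ : ∀ h : D.GtpYdd, D.toTheta h ∈ D.DeltaTheta →
      ((T.coeff.hom (T.thetaRoots.kummerCocycle T.theta_mem h) : D.DeltaTheta) : D.GtpTheta) = D.toTheta h) :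
    ∃ x' : D.H1Theta (D.GtpYdd.map D.toTheta), D.inflTheta D.GtpYdd x' = T.kummerTheta ∧
      ContH1.res (MonoidHom.id D.GtpTheta) D.DeltaTheta
        (hC.deltaTheta_le_DtpYddTheta.trans (Subgroup.map_mono inf_le_left)) x' = D.logTheta := by
  -- the Kummer cocycle of `Θ̈` dies on `Ker toTheta`
  have hf1 : ∀ h : D.GtpYdd, D.toTheta h = 1 →
      (T.coeff.kummerContCocycle D.GtpYdd T.thetaRoots T.theta_mem fun _ => T.isOpen_stabilizer _).1 h = 1 := by
    intro h hh
    rw [CyclotomeCoefficients.kummerContCocycle_apply, ← map_one T.coeff.hom]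
    congr 1
    refine Subtype.ext (funext fun n => ?_)
    rw [RootSystem.kummerCocycle_apply, Subgroup.smul_def, hroots h hh n, div_self']
    rfl
  obtain ⟨g, hg, hgf, hinfl⟩ := ContH1.exists_infl_mk_eq_mk D.continuous_toTheta
    (isOpenMap_of_isQuotientMap hT.isQuotientMap_toTheta) D.ker_toTheta_le_GtpYdd _
    (T.coeff.kummerContCocycle D.GtpYdd T.thetaRoots T.theta_mem fun _ => T.isOpen_stabilizer _).2 hf1
  refine ⟨ContH1.mk g hg, hinfl, ?_⟩
  -- restriction to `Δ_Θ`: `g(δ) = δ` by (hΔ)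
  change ContH1.mk (fun δ : D.DeltaTheta => g ⟨δ.1, _⟩) _ = ContH1.mk _ _
  refine ContH1.mk_congr _ (funext fun δ => ?_) _ _
  obtain ⟨h, hh⟩ : ∃ h : D.GtpYdd, D.toTheta h = δ :=
    ⟨⟨_, (D.mem_GtpYdd_of_toTheta_mem_deltaTheta (x := Classical.choose (D.toTheta_surjective δ))
      (by rw [Classical.choose_spec (D.toTheta_surjective δ)]; exact δ.2)).1⟩,
      Classical.choose_spec (D.toTheta_surjective δ)⟩
  have hmem : D.toTheta h ∈ D.DeltaTheta := by rw [hh]; exact δ.2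
  have e1 : (⟨δ.1, (hC.deltaTheta_le_DtpYddTheta.trans (Subgroup.map_mono inf_le_left)) δ.2⟩ : D.GtpYdd.map D.toTheta)
      = ⟨D.toTheta h, ⟨h, h.2, rfl⟩⟩ := Subtype.ext hh.symm
  apply Subtype.ext
  rw [e1, hgf, CyclotomeCoefficients.kummerContCocycle_apply, hΔ h hmem, hh]

/-- **Uniqueness of the lift** (abc-iut-L2-t12's gen-0 `inflTheta_injective`): the `Θ`-lift of `κ(Θ̈)` is unique,
so "arises from a UNIQUE class" holds for the Kummer class of `Θ̈`. [cite: MochizukiEtTh2009, Prop 1.5 (iii) p.23] -/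
theorem existsUnique_thetaLift_kummerTheta (hC : D.Compat) (hT : D.HasThetaTopology)
    (hroots : ∀ g : D.PiTemp, D.toTheta g = 1 → ∀ n : ℕ+, g • T.thetaRoots.root n = T.thetaRoots.root n)
    (hΔ : ∀ h : D.GtpYdd, D.toTheta h ∈ D.DeltaTheta →
      ((T.coeff.hom (T.thetaRoots.kummerCocycle T.theta_mem h) : D.DeltaTheta) : D.GtpTheta) = D.toTheta h) :
    ∃! x' : D.H1Theta (D.GtpYdd.map D.toTheta), D.inflTheta D.GtpYdd x' = T.kummerTheta ∧
      ContH1.res (MonoidHom.id D.GtpTheta) D.DeltaTheta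
        (hC.deltaTheta_le_DtpYddTheta.trans (Subgroup.map_mono inf_le_left)) x' = D.logTheta := by
  obtain ⟨x', hx', hres⟩ := T.exists_thetaLift_kummerTheta hC hT hroots hΔ
  exact ⟨x', ⟨hx', hres⟩, fun y hy => D.inflTheta_injective D.GtpYdd (hy.1.trans hx'.symm)⟩

end ThetaKummerInput

/-! ### 3. Prop. 1.5 (iii) in full from the Kummer theory of functions -/

namespace KummerCore

variable (C : D.KummerCore) (T : D.ThetaKummerInput)

/-- **Prop. 1.5 (iii) over a Kummer core from the Kummer theory of functions and `HasThetaTopology`** — no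
class-level binder left: `ConstCompat`, «`log(Ü) = κ(Ü)`», (hroots), (hΔ), and the four function identities of
Prop. 1.4 (ii). [cite: MochizukiEtTh2009, Prop 1.5 (iii) p.23] -/
theorem prop15iii_of_thetaKummerInput_of_hasThetaTopology (hC : D.Compat) (hT : D.HasThetaTopology)
    (hcc : T.ConstCompat C.toKummerData)
    {udd : T.Fn} (hu : udd ∈ MulAction.fixedPoints D.GtpYdd T.Fn) (w : RootSystem udd)
    (hlogU : D.inflTheta D.GtpYdd C.logUdd = T.coeff.kummerContClass D.GtpYdd w hu fun _ => T.isOpen_stabilizer _)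
    (hroots : ∀ g : D.PiTemp, D.toTheta g = 1 → ∀ n : ℕ+, g • T.thetaRoots.root n = T.thetaRoots.root n)
    (hΔ : ∀ h : D.GtpYdd, D.toTheta h ∈ D.DeltaTheta →
      ((T.coeff.hom (T.thetaRoots.kummerCocycle T.theta_mem h) : D.DeltaTheta) : D.GtpTheta) = D.toTheta h)
    {σ₀ : D.PiTemp} (hσ₀ : D.toZ σ₀ = Multiplicative.ofAdd 1)
    (hU₀ : ∃ u ∈ D.unitsOKdd, σ₀ • udd = T.const (u * D.qddUnit) * udd)
    (hUY : ∀ y ∈ D.GtpY, ∃ u ∈ D.unitsOKdd, y • udd = T.const u * udd)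
    (hΘ₀ : ∃ u ∈ D.unitsOKdd, σ₀ • T.theta = T.const (u * D.qddUnit⁻¹) * udd ^ (-(2 : ℤ)) * T.theta)
    (hΘY : ∀ y ∈ D.GtpY, ∃ u ∈ D.unitsOKdd, y • T.theta = T.const u * T.theta) :
    Prop15iii (C.toKummerData.etaleThetaDataOfClass T.kummerTheta) hC := by
  obtain ⟨x', hx', hres⟩ := T.exists_thetaLift_kummerTheta hC hT hroots hΔ
  exact C.prop15iii_etaleThetaDataOfClass_of_thetaKummerInput T hC hcc hu w hlogU x' hx' hres hσ₀ hU₀ hUY hΘ₀ hΘY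

section OfSection

variable (s : GQp p →* D.PiTemp) (hs : Continuous s) (hsec : ∀ σ : GQp p, D.aug (s σ) = σ)
  (hsY : D.GK.map s ≤ D.GtpY) (hsYdd : D.GKdd.map s ≤ D.GtpYdd)

/-- **The same at the section datum** (carrier `H¹(G_K̈, Δ_Θ)`). [cite: MochizukiEtTh2009, Prop 1.5 (iii) p.23] -/
theorem prop15iii_ofSection_of_thetaKummerInput_of_hasThetaTopology (hC : D.Compat) (hT : D.HasThetaTopology)
    (hcc : T.ConstCompat C.toKummerData)
    {udd : T.Fn} (hu : udd ∈ MulAction.fixedPoints D.GtpYdd T.Fn) (w : RootSystem udd)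
    (hlogU : D.inflTheta D.GtpYdd C.logUdd = T.coeff.kummerContClass D.GtpYdd w hu fun _ => T.isOpen_stabilizer _)
    (hroots : ∀ g : D.PiTemp, D.toTheta g = 1 → ∀ n : ℕ+, g • T.thetaRoots.root n = T.thetaRoots.root n)
    (hΔ : ∀ h : D.GtpYdd, D.toTheta h ∈ D.DeltaTheta →
      ((T.coeff.hom (T.thetaRoots.kummerCocycle T.theta_mem h) : D.DeltaTheta) : D.GtpTheta) = D.toTheta h)
    {σ₀ : D.PiTemp} (hσ₀ : D.toZ σ₀ = Multiplicative.ofAdd 1)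
    (hU₀ : ∃ u ∈ D.unitsOKdd, σ₀ • udd = T.const (u * D.qddUnit) * udd)
    (hUY : ∀ y ∈ D.GtpY, ∃ u ∈ D.unitsOKdd, y • udd = T.const u * udd)
    (hΘ₀ : ∃ u ∈ D.unitsOKdd, σ₀ • T.theta = T.const (u * D.qddUnit⁻¹) * udd ^ (-(2 : ℤ)) * T.theta)
    (hΘY : ∀ y ∈ D.GtpY, ∃ u ∈ D.unitsOKdd, y • T.theta = T.const u * T.theta) :
    Prop15iii ((C.toKummerDataOfSection s hs hsec hsY hsYdd).etaleThetaDataOfClass T.kummerTheta) hC := by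
  obtain ⟨x', hx', hres⟩ := T.exists_thetaLift_kummerTheta hC hT hroots hΔ
  exact C.prop15iii_etaleThetaDataOfClass_ofSection_of_thetaKummerInput T s hs hsec hsY hsYdd hC hcc hu w hlogU x'
    hx' hres hσ₀ hU₀ hUY hΘ₀ hΘY

end OfSection

end KummerCore

namespace EtaleThetaData

/-- **Prop. 1.5 (iii) for ANY étale-theta datum with `η̈^Θ = κ(Θ̈)`, from the Kummer theory of functions and
`HasThetaTopology`** (Kummer-side binders `hkres`/`hU`/`hQ` of a bare Kummer datum kept).
[cite: MochizukiEtTh2009, Prop 1.5 (iii) p.23] -/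
theorem prop15iii_of_thetaKummerInput_of_hasThetaTopology (E : D.EtaleThetaData) (T : D.ThetaKummerInput)
    (hC : D.Compat) (hT : D.HasThetaTopology) (hη : E.etaDd = T.kummerTheta) (hcc : T.ConstCompat E.toKummerData)
    {udd : T.Fn} (hu : udd ∈ MulAction.fixedPoints D.GtpYdd T.Fn) (w : RootSystem udd)
    (hlogU : D.inflTheta D.GtpYdd E.logUdd = T.coeff.kummerContClass D.GtpYdd w hu fun _ => T.isOpen_stabilizer _)
    (hroots : ∀ g : D.PiTemp, D.toTheta g = 1 → ∀ n : ℕ+, g • T.thetaRoots.root n = T.thetaRoots.root n)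
    (hΔ : ∀ h : D.GtpYdd, D.toTheta h ∈ D.DeltaTheta →
      ((T.coeff.hom (T.thetaRoots.kummerCocycle T.theta_mem h) : D.DeltaTheta) : D.GtpTheta) = D.toTheta h)
    (hkres : ∀ u ∈ D.unitsOKdd, ContH1.res (MonoidHom.id D.GtpTheta) D.DeltaTheta
      (hC.deltaTheta_le_DtpYddTheta.trans (Subgroup.map_mono inf_le_left)) (E.kumYdd (E.toKddHat u)) = 1)
    (hU : haveI := hC.GtpYddTheta_normal
      ∀ σ : D.PiTemp, ∀ u ∈ D.unitsOKdd, ∃ u' ∈ D.unitsOKdd,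
        ContH1.conj (MonoidHom.id D.GtpTheta) D.DeltaTheta (D.toTheta σ) (E.kumYdd (E.toKddHat u)) =
          E.kumYdd (E.toKddHat u'))
    (hQ : haveI := hC.GtpYddTheta_normal
      ∀ σ : D.PiTemp, ∃ u ∈ D.unitsOKdd,
        ContH1.conj (MonoidHom.id D.GtpTheta) D.DeltaTheta (D.toTheta σ) (E.kumYdd (E.toKddHat D.qddUnit)) =
          E.kumYdd (E.toKddHat D.qddUnit) * E.kumYdd (E.toKddHat u))
    {σ₀ : D.PiTemp} (hσ₀ : D.toZ σ₀ = Multiplicative.ofAdd 1)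
    (hU₀ : ∃ u ∈ D.unitsOKdd, σ₀ • udd = T.const (u * D.qddUnit) * udd)
    (hUY : ∀ y ∈ D.GtpY, ∃ u ∈ D.unitsOKdd, y • udd = T.const u * udd)
    (hΘ₀ : ∃ u ∈ D.unitsOKdd, σ₀ • T.theta = T.const (u * D.qddUnit⁻¹) * udd ^ (-(2 : ℤ)) * T.theta)
    (hΘY : ∀ y ∈ D.GtpY, ∃ u ∈ D.unitsOKdd, y • T.theta = T.const u * T.theta) :
    Prop15iii E hC := by
  obtain ⟨x', hx', hres⟩ := T.exists_thetaLift_kummerTheta hC hT hroots hΔ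
  exact E.prop15iii_of_thetaKummerInput T hC hη hcc hu w hlogU x' hx' hres hkres hU hQ hσ₀ hU₀ hUY hΘ₀ hΘY

end EtaleThetaData

end ThetaSetting

end Literature.AnabelianGeometry.EtaleTheta

end
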